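import Summits.QuantumFields.YangMills.Theorems.LuscherReductionTwistedTraceScalingWindowOnion
import Summits.QuantumFields.YangMills.Theorems.LuscherReductionTwistedTraceScalingWindowOneOrbit
import Summits.QuantumFields.YangMills.Theorems.LuscherReductionTwistedTraceScalingBaseOfWindow
import HarnessLib

/-!
# ★★★★ THE LATTICE WINDOW FLOOR W(L) for every `L ≥ 2` ⟸ the LOG-RATE VALLEY GAIN at the core radius `β^{−19/100}`; S-BASE ⟸ the same
# (brick W7 of the card `pub/ym-fleet/ym-luscher-20007-p1/Lines-window-floor.md`; lane A of S-BASE, crux `TwistedTraceScaling` stmt-QuantumFields-20203, line «twolattice»,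
# stub `stub_fixedLatticeTraceLaw`; lead g24)

W(L) — the hypothesis `hW` of ✓`Base.fixedLatticeTraceLaw_of_upper_lower_window L` — is the `k`-UNIFORM floor
  `∀ c₁ > 0, ∃ g ≥ 0 Laplace-summable, ∃ β₀, ∀ β ≥ β₀, ∀ k, λ_k(β,L) ≤ exp(−(Λ(β,L)/L)·min (g k) (c₁ log β))·λ₀(β,L)`.
THIS FILE derives it from BO-WINDOW(L) (✓`boWindow_pow`, W6) fed with the UNCONDITIONAL `k`-uniform inner window ✓`innerWindowOneOrbitAt_record` (W4, `s = 19/100`) and the log-rate valley gain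
`ValleyGainLogAt L (β^{−19/100}) (β^{−17/20})` (bricks R1–R5 of the card; a HYPOTHESIS here), the one-site window floor ✓`OST.windowFloor_all` re-instantiated at `B = L³β` (cap `2c₁+1`),
and the label comparison `Λ/L ≤ 2λ_b(L³β)` (✓`exists_luscherLambda_le_mul_bareLambda`).  Profile: `g k = max 0 ((g^OS k − 1)/4)` (`g 0 = 0`, one `g` per cap, cdisprove R72).
* `exp_gap`, `window_level_arith` — the real arithmetic of one level;
* ★★★★ `windowFloor_of_valleyLog (hL2 : 2 ≤ L) (hV) : W(L)`;
* ★★★★ `stmt_of_valleyLog (hV : ∀ L₁ ≥ 2, ValleyGainLogAt L₁ (β^{−19/100}) (β^{−17/20}))` : VERBATIM the body of the registered stub `TwoLattice.Stmt.stub_fixedLatticeTraceLaw` (✓`Base.stmt_of_window`).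
HONEST FRAMING: fixed lattice size `L ≥ 2`, eventually in `β` (astronomical thresholds); S-BASE modulo ONE log-rate valley gain; `stub_cmpTwoLoop`, `stub_labelTracking` and the crux
`TwistedTraceScaling` stay OPEN; CONDITIONAL route R2b1 (Lüscher two-lattice reduction); not infinite volume, not a mass gap, not Clay.  No definitions, no `sorry`.
-/

set_option autoImplicit false

noncomputable section

open MeasureTheory Filter Topology Real
open scoped BigOperators
open Literature.MathematicalPhysics.QuantumFieldTheory
open Literature.MathematicalPhysics.QuantumLattice

namespace Summit.QuantumFields.YangMills.Theorems.FemtoTransferGap.TwoLattice.ConstTube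

open Summit.QuantumFields.YangMills.Theorems.FemtoTransferGap
open Summit.QuantumFields.YangMills.Theorems.FemtoTransferGap.TraceDoor

variable {L : ℕ} [NeZero L]

/-! ## §1 The arithmetic of one level -/

omit [NeZero L] in
/-- `e^{−x} − e^{−y} ≥ e^{−y}(y − x)` (all real `x, y`: convexity). [folklore] -/
theorem exp_gap (x y : ℝ) : Real.exp (-y) * (y - x) ≤ Real.exp (-x) - Real.exp (-y) := by
  have h1 : Real.exp (-x) = Real.exp (-y) * Real.exp (y - x) := by rw [← Real.exp_add]; congr 1; ring
  have h2 : y - x + 1 ≤ Real.exp (y - x) := Real.add_one_le_exp _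
  rw [h1]
  nlinarith [Real.exp_pos (-y), h2]

omit [NeZero L] in
/-- ★ **One level of the window**: the one-site floor `μ_k ≤ e^{−λ·min G (c' log B)}μ₀` (`c' = 2c₁+1`), BO-WINDOW `λ_k μ₀ ≤ (max μ_k (e^{−c'ℓλ}μ₀) + (λ/4)μ₀)Λ₀` (`ℓ = log β ≤ log B`,
`ℓ ≥ 1/2`), smallness `λ·(c' log B) ≤ log 2` and `G > 1` give `λ_k ≤ e^{−2λ·min ((G−1)/4) (c₁ℓ)}·Λ₀`. [folklore] -/
theorem window_level_arith {lk Λ0 μ0 μk lam G ℓ logB c₁ : ℝ} (hlam : 0 < lam) (hμ0 : 0 < μ0) (hΛ0 : 0 ≤ Λ0) (hc₁ : 0 < c₁) (hℓ : 1 / 2 ≤ ℓ)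
    (hℓB : ℓ ≤ logB) (hG : 1 < G) (hsm : lam * ((2 * c₁ + 1) * logB) ≤ Real.log 2)
    (hμ : μk ≤ Real.exp (-(lam * min G ((2 * c₁ + 1) * logB))) * μ0)
    (hX : lk * μ0 ≤ (max μk (Real.exp (-((2 * c₁ + 1) * ℓ * lam)) * μ0) + 1 / 4 * lam * μ0) * Λ0) :
    lk ≤ Real.exp (-(2 * lam * min ((G - 1) / 4) (c₁ * ℓ))) * Λ0 := by
  set m : ℝ := min ((G - 1) / 4) (c₁ * ℓ) with hm
  have hm1 : m ≤ (G - 1) / 4 := min_le_left _ _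
  have hm2 : m ≤ c₁ * ℓ := min_le_right _ _
  have hlog2 : Real.log 2 < 1 := by
    have := Real.log_two_lt_d9; linarith
  -- `e^{−x} ≥ 1/2` whenever `x ≤ log 2`
  have hhalf : ∀ x : ℝ, x ≤ Real.log 2 → 1 / 2 ≤ Real.exp (-x) := fun x hx => by
    rw [Real.exp_neg, le_inv_comm₀ (by norm_num) (Real.exp_pos x)]
    calc Real.exp x ≤ Real.exp (Real.log 2) := Real.exp_le_exp.mpr hx
      _ = 2 := Real.exp_log (by norm_num)
      _ = (1 / 2)⁻¹ := by norm_num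
  -- claim B: `e^{−c'ℓλ} + λ/4 ≤ e^{−2λm}`
  have hℓB' : (2 * c₁ + 1) * ℓ * lam ≤ lam * ((2 * c₁ + 1) * logB) := by
    have h := mul_le_mul_of_nonneg_left hℓB (by positivity : (0 : ℝ) ≤ (2 * c₁ + 1) * lam)
    have e1 : (2 * c₁ + 1) * ℓ * lam = (2 * c₁ + 1) * lam * ℓ := by ring
    have e2 : lam * ((2 * c₁ + 1) * logB) = (2 * c₁ + 1) * lam * logB := by ring
    rw [e1, e2]; exact h
  have hcℓ : (2 * c₁ + 1) * ℓ * lam ≤ Real.log 2 := hℓB'.trans hsm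
  have hB : Real.exp (-((2 * c₁ + 1) * ℓ * lam)) + 1 / 4 * lam ≤ Real.exp (-(2 * lam * m)) := by
    have h1 := exp_gap (2 * c₁ * ℓ * lam) ((2 * c₁ + 1) * ℓ * lam)
    have h2 : 1 / 2 ≤ Real.exp (-((2 * c₁ + 1) * ℓ * lam)) := hhalf _ hcℓ
    have h3 : (2 * c₁ + 1) * ℓ * lam - 2 * c₁ * ℓ * lam = ℓ * lam := by ring
    rw [h3] at h1
    have h4 : 1 / 4 * lam ≤ Real.exp (-((2 * c₁ + 1) * ℓ * lam)) * (ℓ * lam) := by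
      have h4a : (1 / 2 : ℝ) * (1 / 2) ≤ Real.exp (-((2 * c₁ + 1) * ℓ * lam)) * ℓ := mul_le_mul h2 hℓ (by norm_num) (Real.exp_pos _).le
      have h4b := mul_le_mul_of_nonneg_right h4a hlam.le
      rw [mul_assoc] at h4b
      linarith
    have h5 : Real.exp (-(2 * c₁ * ℓ * lam)) ≤ Real.exp (-(2 * lam * m)) := Real.exp_le_exp.mpr (by nlinarith)
    linarith
  -- claim A: `e^{−λ·min G (c' log B)} + λ/4 ≤ e^{−2λm}`
  have hA : Real.exp (-(lam * min G ((2 * c₁ + 1) * logB))) + 1 / 4 * lam ≤ Real.exp (-(2 * lam * m)) := by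
    rcases le_total G ((2 * c₁ + 1) * logB) with hle | hle
    · rw [min_eq_left hle]
      have h1 := exp_gap (lam * ((G - 1) / 2)) (lam * G)
      have hGB : lam * G ≤ lam * ((2 * c₁ + 1) * logB) := mul_le_mul_of_nonneg_left hle hlam.le
      have h2 : 1 / 2 ≤ Real.exp (-(lam * G)) := hhalf _ (hGB.trans hsm)
      have h3 : lam * G - lam * ((G - 1) / 2) = lam * ((G + 1) / 2) := by ring
      rw [h3] at h1
      have h4 : 1 / 4 * lam ≤ Real.exp (-(lam * G)) * (lam * ((G + 1) / 2)) := by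
        have h4a : (1 / 2 : ℝ) * 1 ≤ Real.exp (-(lam * G)) * ((G + 1) / 2) :=
          mul_le_mul h2 (by linarith) (by norm_num) (Real.exp_pos _).le
        have h4b := mul_le_mul_of_nonneg_left h4a hlam.le
        have e : Real.exp (-(lam * G)) * (lam * ((G + 1) / 2)) = lam * (Real.exp (-(lam * G)) * ((G + 1) / 2)) := by ring
        rw [e]; linarith
      have h5 : Real.exp (-(lam * ((G - 1) / 2))) ≤ Real.exp (-(2 * lam * m)) := Real.exp_le_exp.mpr (by nlinarith)
      linarith
    · rw [min_eq_right hle]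
      have h1 : Real.exp (-(lam * ((2 * c₁ + 1) * logB))) ≤ Real.exp (-((2 * c₁ + 1) * ℓ * lam)) := Real.exp_le_exp.mpr (by linarith [hℓB'])
      linarith
  -- assemble
  have hmax : max μk (Real.exp (-((2 * c₁ + 1) * ℓ * lam)) * μ0) + 1 / 4 * lam * μ0 ≤ Real.exp (-(2 * lam * m)) * μ0 := by
    rcases le_total μk (Real.exp (-((2 * c₁ + 1) * ℓ * lam)) * μ0) with hle | hle
    · rw [max_eq_right hle]; nlinarith
    · rw [max_eq_left hle]
      have := mul_le_mul_of_nonneg_right hA hμ0.le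
      nlinarith
  have h1 : lk * μ0 ≤ Real.exp (-(2 * lam * m)) * μ0 * Λ0 := hX.trans (mul_le_mul_of_nonneg_right hmax hΛ0)
  have h2 : lk * μ0 ≤ (Real.exp (-(2 * lam * m)) * Λ0) * μ0 := by linarith
  exact le_of_mul_le_mul_right h2 hμ0

/-! ## §2 ★★★★ W(L) from the log-rate valley gain -/

set_option maxHeartbeats 400000 in
/-- ★★★★ **THE LATTICE WINDOW FLOOR W(L) (`L ≥ 2`) from the log-rate valley gain at the core radius** — VERBATIM the hypothesis `hW` of ✓`Base.fixedLatticeTraceLaw_of_upper_lower_window L`.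
Profile `g k = max 0 ((g^OS k − 1)/4)` from ✓`OST.windowFloor_all (2c₁+1)` at `B = L³β`; BO-WINDOW(L) ✓`boWindow_pow` at `(19/100, 17/20)` with `c = 2c₁+1`, `ε = 1/4`, fed by
✓`innerWindowOneOrbitAt_record`; labels `Λ/L ≤ 2λ_b(L³β)`. [cite: Luscher1983, §3] [cite: SimonB1983DiscreteSpectrum, Cor. 4] -/
theorem windowFloor_of_valleyLog (hL2 : 2 ≤ L) (hV : ValleyGainLogAt L (powScale (19 / 100)) (powScale (17 / 20))) :
    ∀ c₁ : ℝ, 0 < c₁ → ∃ g : ℕ → ℝ, (∀ k, 0 ≤ g k) ∧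
      (∀ t : ℝ, 0 < t → Summable fun k : ℕ => Real.exp (-t * g k)) ∧
      ∃ β0 : ℝ, ∀ β : ℝ, β0 ≤ β → ∀ k : ℕ,
        levelValue su2Rep L β k ≤
          Real.exp (-(luscherLambda β L / L * min (g k) (c₁ * Real.log β))) * levelValue su2Rep L β 0 := by
  intro c₁ hc₁
  have hL0 : (0 : ℝ) < L := by exact_mod_cast Nat.pos_of_ne_zero (NeZero.ne L)
  have hL1 : (1 : ℝ) ≤ (L : ℝ) ^ 3 := one_le_pow₀ (by exact_mod_cast NeZero.one_le)
  have hc' : 0 < 2 * c₁ + 1 := by linarith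
  obtain ⟨gOS, hg0, hgsum, B0, hfloor⟩ := OST.windowFloor_all (2 * c₁ + 1) hc'
  obtain ⟨βW, hW⟩ := boWindow_pow (L := L) (p := 19 / 100) (q := 17 / 20) (by norm_num) (by norm_num) (by norm_num) hV
    (innerWindowOneOrbitAt_record hL2 (by norm_num) (by norm_num)) (2 * c₁ + 1) (1 / 4) (by norm_num)
  obtain ⟨T, -, hT⟩ := OST.log_mul_bareLambda_le (c := Real.log 2 / (2 * c₁ + 1)) (by have := Real.log_pos (show (1:ℝ) < 2 by norm_num); positivity)
  obtain ⟨βu, hu⟩ := BOHandover.exists_luscherLambda_le_mul_bareLambda L (η := 1) one_pos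
  obtain ⟨βp, hp⟩ := Base.eventually_unit_le L one_pos
  refine ⟨fun k => max 0 ((gOS k - 1) / 4), fun k => le_max_left _ _, fun t ht => ?_,
    max (max βW B0) (max (max T (Real.exp 1)) (max βu βp)), fun β hβ k => ?_⟩
  · -- summability of the shifted profile
    have hs := (hgsum (t / 4) (by positivity)).mul_left (Real.exp (t / 4))
    refine Summable.of_nonneg_of_le (fun k => (Real.exp_pos _).le) (fun k => ?_) hs
    rw [← Real.exp_add]
    refine Real.exp_le_exp.mpr ?_
    have h1 : (gOS k - 1) / 4 ≤ max 0 ((gOS k - 1) / 4) := le_max_right _ _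
    nlinarith
  · have hβW : βW ≤ β := ((le_max_left _ _).trans (le_max_left _ _)).trans hβ
    have hβB0 : B0 ≤ β := ((le_max_right _ _).trans (le_max_left _ _)).trans hβ
    have hβT : T ≤ β := (((le_max_left _ _).trans (le_max_left _ _)).trans (le_max_right _ _)).trans hβ
    have hβe : Real.exp 1 ≤ β := (((le_max_right _ _).trans (le_max_left _ _)).trans (le_max_right _ _)).trans hβ
    have hβu : βu ≤ β := (((le_max_left _ _).trans (le_max_right _ _)).trans (le_max_right _ _)).trans hβ
    have hβp : βp ≤ β := (((le_max_right _ _).trans (le_max_right _ _)).trans (le_max_right _ _)).trans hβ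
    obtain ⟨hβ1, hupos, -⟩ := hp β hβp
    have hβ0 : 0 < β := by linarith
    set B : ℝ := (L : ℝ) ^ 3 * β with hBdef
    have hBβ : β ≤ B := by rw [hBdef]; nlinarith
    have hBpos : 0 < B := lt_of_lt_of_le hβ0 hBβ
    have hB1 : 1 ≤ B := hβ1.trans hBβ
    have hlam0 : 0 < bareLambda B := bareLambda_pos' hBpos
    have hμ0 : 0 < levelValue su2Rep 1 B 0 := levelValue_su2Rep_pos (L := 1) hBpos 0
    have hΛ0 : 0 < levelValue su2Rep L β 0 := levelValue_su2Rep_pos hβ0 0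
    -- labels: `Λ/L ≤ 2λ_b`
    have hΛpos : 0 < luscherLambda β L := by
      have := mul_pos hupos hL0; rwa [div_mul_cancel₀ _ hL0.ne'] at this
    have hul : luscherLambda β L / L ≤ 2 * bareLambda B := by
      rw [div_le_iff₀ hL0]
      have h := hu β hβu hΛpos
      rw [hBdef]; linarith
    -- `log β ≥ 1 ≥ 1/2`, `log β ≤ log B`
    have hℓ1 : 1 ≤ Real.log β := by
      have := Real.log_le_log (Real.exp_pos 1) hβe; rwa [Real.log_exp] at this
    have hℓ0 : 0 ≤ Real.log β := by linarith
    have hℓB : Real.log β ≤ Real.log B := Real.log_le_log hβ0 hBβ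
    show levelValue su2Rep L β k ≤ Real.exp (-(luscherLambda β L / L * min (max 0 ((gOS k - 1) / 4)) (c₁ * Real.log β))) * levelValue su2Rep L β 0
    -- the easy case `g k = 0`: `λ_k ≤ λ₀`
    by_cases hGk : gOS k ≤ 1
    · have hg0' : max 0 ((gOS k - 1) / 4) = 0 := max_eq_left (by linarith)
      rw [hg0']
      have hmin : min (0 : ℝ) (c₁ * Real.log β) = 0 := min_eq_left (by positivity)
      rw [hmin, mul_zero, neg_zero, Real.exp_zero, one_mul]
      exact levelValue_le_of_le hβ0 (Nat.zero_le k)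
    · push Not at hGk
      have hgk : max 0 ((gOS k - 1) / 4) = (gOS k - 1) / 4 := max_eq_right (by linarith)
      rw [hgk]
      -- smallness `λ·((2c₁+1) log B) ≤ log 2`
      have hsm : bareLambda B * ((2 * c₁ + 1) * Real.log B) ≤ Real.log 2 := by
        have h1 := hT B (hβT.trans hBβ)
        have h2 : B ^ (-(1 / 4 : ℝ)) ≤ 1 := Real.rpow_le_one_of_one_le_of_nonpos hB1 (by norm_num)
        have h3 : 0 ≤ Real.log 2 / (2 * c₁ + 1) := by have := Real.log_pos (show (1:ℝ) < 2 by norm_num); positivity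
        have h4 : Real.log B * bareLambda B ≤ Real.log 2 / (2 * c₁ + 1) := h1.trans (by nlinarith)
        have h5 : bareLambda B * ((2 * c₁ + 1) * Real.log B) = (2 * c₁ + 1) * (Real.log B * bareLambda B) := by ring
        rw [h5]
        have := mul_le_mul_of_nonneg_left h4 hc'.le
        rwa [mul_div_cancel₀ _ hc'.ne'] at this
      -- the one-site floor and BO-WINDOW at this `β`, `k`
      have hμ := hfloor B (hβB0.trans hBβ) k
      have hX := hW β hβW k
      have hX' : levelValue su2Rep L β k * levelValue su2Rep 1 B 0 ≤
          (max (levelValue su2Rep 1 B k) (Real.exp (-((2 * c₁ + 1) * Real.log β * bareLambda B)) * levelValue su2Rep 1 B 0) +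
            1 / 4 * bareLambda B * levelValue su2Rep 1 B 0) * levelValue su2Rep L β 0 := hX
      have hmain := window_level_arith hlam0 hμ0 hΛ0.le hc₁ (by linarith) hℓB hGk hsm hμ hX'
      refine hmain.trans (mul_le_mul_of_nonneg_right (Real.exp_le_exp.mpr ?_) hΛ0.le)
      -- `−2λ m ≤ −(Λ/L) m` since `Λ/L ≤ 2λ`, `m ≥ 0`
      have hm0 : 0 ≤ min ((gOS k - 1) / 4) (c₁ * Real.log β) := le_min (by linarith) (by positivity)
      have := mul_le_mul_of_nonneg_right hul hm0
      linarith

/-! ## §3 ★★★★ S-BASE from the log-rate valley gain -/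

/-- ★★★★ **THE REGISTERED STUB `stub_fixedLatticeTraceLaw` (S-BASE of line «twolattice») MODULO THE LOG-RATE VALLEY GAIN at the core radius for every `L ≥ 2`** — conclusion =
VERBATIM the body of `TwoLattice.Stmt.stub_fixedLatticeTraceLaw` (✓`Base.stmt_of_window` ∘ `windowFloor_of_valleyLog`). [cite: Luscher1983, §3] [cite: MontvayMunster1994, (3.145)] -/
theorem stmt_of_valleyLog
    (hV : ∀ (L1 : ℕ) [NeZero L1], 2 ≤ L1 → ValleyGainLogAt L1 (powScale (19 / 100)) (powScale (17 / 20))) :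
    ∀ (L1 : ℕ) [NeZero L1] (s : ℝ), 0 < s → ∀ ε : ℝ, 0 < ε → ∃ β1 : ℝ, ∀ β : ℝ, β1 ≤ β →
      |traceRatio L1 β (femtoSteps s β L1) - hTraceRatio s| ≤ ε :=
  Base.stmt_of_window fun L1 _ hL1 => windowFloor_of_valleyLog hL1 (hV L1 hL1)

end Summit.QuantumFields.YangMills.Theorems.FemtoTransferGap.TwoLattice.ConstTube

end
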